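import Mathlib
import Summits.Ventures.PercRepro.TriangleCapPhiBound
import Summits.Ventures.PercRepro.TriangleCapBipStar

/-!
# PercRepro — THE RESIDUE BOUND FOR BIPARTITE GRAPHS OF THE BAND: `t (t − 1) + 2 φ_D(t) ≤ 2 j + 2 t (D − 1)`
(p3, gen 55; part 302)

When `H` is bipartite (`BipSub H A`: every edge crosses `A`), every off-edge of `w` has exactly one end in `A` and
one outside, and neither end is `w`: the off-degrees sum to `t` on each side (`sum_offDeg_side_eq`).  The residue
bound of part 301 on each side then gives, for every off-degree `≤ D`,

  **`t (t − 1) + 2 φ_D(t) ≤ 2 j + 2 t (D − 1)`**   (`band_ge_two_phi_of_bipSub`)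

— the regular bound sharpened by `2 r (D − r)`, `r = t mod D`, with NO restriction on the inside edges: in a
bipartite graph the parity trick of part 301 is unavailable.  So on the bipartite graphs of the band the g54
conjecture's "else" branch is a theorem for every `ℓ` (the bound here; the near-regular witness `(D^m, r)` on both
sides, part 303, attains it for `D ≤ m = ⌊t/D⌋`).  Axioms: standard.
-/

namespace PercRepro

namespace TriangleCap

namespace C047

open Finset

variable {V : Type*} [Fintype V] [DecidableEq V]

/-- The off-degree sum over a set of vertices meeting every off-edge exactly once is the number of off-edges. -/
theorem sum_offDeg_filter_eq (H : SimpleGraph V) [DecidableRel H.Adj] (w : V) (P : V → Prop) [DecidablePred P]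
    (hP : ∀ e ∈ offEdges H w, ((univ.filter P).filter (fun v => v ∈ e)).card = 1) :
    ∑ v ∈ univ.filter P, offDeg H w v = (offEdges H w).card := by
  unfold offDeg
  simp_rw [card_filter]
  rw [sum_comm]
  rw [card_eq_sum_ones]
  apply sum_congr rfl
  intro e he
  have h := hP e he
  rw [card_filter] at h
  exact h

/-- In a bipartite `H` (`BipSub H A`), every off-edge of `w` has exactly one end in `A ∖ {w}`. -/
theorem card_filter_mem_of_bipSub (H : SimpleGraph V) [DecidableRel H.Adj] (w : V) (A : Finset V)
    (hA : BipSub H A) (e : Sym2 V) (he : e ∈ offEdges H w) :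
    ((univ.filter (fun v => v ∈ A ∧ v ≠ w)).filter (fun v => v ∈ e)).card = 1 := by
  obtain ⟨he1, he2⟩ := (mem_offEdges H w e).mp he
  induction e using Sym2.inductionOn with
  | hf x y =>
    rw [SimpleGraph.mem_edgeFinset, SimpleGraph.mem_edgeSet] at he1
    have hxw : x ≠ w := fun h => he2 (h ▸ Sym2.mem_mk_left x y)
    have hyw : y ≠ w := fun h => he2 (h ▸ Sym2.mem_mk_right x y)
    have hxy := hA x y he1
    rw [card_eq_one]
    by_cases hx : x ∈ A
    · refine ⟨x, ?_⟩
      ext v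
      simp only [mem_filter, mem_univ, true_and, Sym2.mem_iff, mem_singleton]
      constructor
      · rintro ⟨⟨hvA, -⟩, hv | hv⟩
        · exact hv
        · exfalso
          exact hxy.mp hx (hv ▸ hvA)
      · rintro rfl
        exact ⟨⟨hx, hxw⟩, Or.inl rfl⟩
    · have hy : y ∈ A := by
        by_contra hy
        exact hx (hxy.mpr hy)
      refine ⟨y, ?_⟩
      ext v
      simp only [mem_filter, mem_univ, true_and, Sym2.mem_iff, mem_singleton]
      constructor
      · rintro ⟨⟨hvA, -⟩, hv | hv⟩
        · exfalso
          exact hx (hv ▸ hvA)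
        · exact hv
      · rintro rfl
        exact ⟨⟨hy, hyw⟩, Or.inr rfl⟩

/-- In a bipartite `H` (`BipSub H A`), every off-edge of `w` has exactly one end outside `A` (and `≠ w`). -/
theorem card_filter_notMem_of_bipSub (H : SimpleGraph V) [DecidableRel H.Adj] (w : V) (A : Finset V)
    (hA : BipSub H A) (e : Sym2 V) (he : e ∈ offEdges H w) :
    ((univ.filter (fun v => v ∉ A ∧ v ≠ w)).filter (fun v => v ∈ e)).card = 1 := by
  obtain ⟨he1, he2⟩ := (mem_offEdges H w e).mp he
  induction e using Sym2.inductionOn with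
  | hf x y =>
    rw [SimpleGraph.mem_edgeFinset, SimpleGraph.mem_edgeSet] at he1
    have hxw : x ≠ w := fun h => he2 (h ▸ Sym2.mem_mk_left x y)
    have hyw : y ≠ w := fun h => he2 (h ▸ Sym2.mem_mk_right x y)
    have hxy := hA x y he1
    rw [card_eq_one]
    by_cases hx : x ∈ A
    · have hy : y ∉ A := hxy.mp hx
      refine ⟨y, ?_⟩
      ext v
      simp only [mem_filter, mem_univ, true_and, Sym2.mem_iff, mem_singleton]
      constructor
      · rintro ⟨⟨hvA, -⟩, hv | hv⟩
        · exfalso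
          exact hvA (hv ▸ hx)
        · exact hv
      · rintro rfl
        exact ⟨⟨hy, hyw⟩, Or.inr rfl⟩
    · refine ⟨x, ?_⟩
      ext v
      simp only [mem_filter, mem_univ, true_and, Sym2.mem_iff, mem_singleton]
      constructor
      · rintro ⟨⟨hvA, -⟩, hv | hv⟩
        · exact hv
        · exfalso
          exact hx (hxy.mpr (hv ▸ hvA))
      · rintro rfl
        exact ⟨⟨hx, hxw⟩, Or.inl rfl⟩

/-- **THE OFF-DEGREE SUMS OF THE TWO SIDES:** in a bipartite `H` the off-degrees of `w` sum to `t` over `A ∖ {w}`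
and to `t` over `Aᶜ ∖ {w}`. -/
theorem sum_offDeg_side_eq (H : SimpleGraph V) [DecidableRel H.Adj] (w : V) (A : Finset V) (hA : BipSub H A) :
    ∑ v ∈ univ.filter (fun v => v ∈ A ∧ v ≠ w), offDeg H w v = (offEdges H w).card ∧
      ∑ v ∈ univ.filter (fun v => v ∉ A ∧ v ≠ w), offDeg H w v = (offEdges H w).card :=
  ⟨sum_offDeg_filter_eq H w _ (card_filter_mem_of_bipSub H w A hA),
    sum_offDeg_filter_eq H w _ (card_filter_notMem_of_bipSub H w A hA)⟩

/-- The split of `Σ_{v ≠ w} f v` into the two sides of `A`. -/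
theorem sum_erase_eq_side_add_side (w : V) (A : Finset V) (f : V → ℕ) :
    ∑ v ∈ univ.erase w, f v = ∑ v ∈ univ.filter (fun v => v ∈ A ∧ v ≠ w), f v +
      ∑ v ∈ univ.filter (fun v => v ∉ A ∧ v ≠ w), f v := by
  rw [← sum_filter_add_sum_filter_not (univ.erase w) (fun v => v ∈ A) f]
  congr 1
  · apply sum_congr _ (fun _ _ => rfl)
    ext v
    simp only [mem_filter, mem_erase, mem_univ, true_and, and_true]
    tauto
  · apply sum_congr _ (fun _ _ => rfl)
    ext v
    simp only [mem_filter, mem_erase, mem_univ, true_and, and_true]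
    tauto

/-- **THE RESIDUE BOUND FOR BIPARTITE GRAPHS OF THE BAND:** for every triangle-free bipartite `H` (`BipSub H A`)
with `s` edges, `w` of degree `s − t ≥ 1`, every off-degree `≤ D`, at the band value `2 j`:
`t (t − 1) + 2 φ_D(t) ≤ 2 j + 2 t (D − 1)` — inside edges or not. -/
theorem band_ge_two_phi_of_bipSub (H : SimpleGraph V) [DecidableRel H.Adj] (hfree : H.CliqueFree 3) (s t j D : ℕ)
    (hs : H.edgeFinset.card = s) (w : V) (hw : deg H w + t = s) (hw1 : 1 ≤ deg H w)
    (hj : ∑ v, deg H v * deg H v + 2 * (t * (s - t - 1)) + 2 * j = s * (s + 1))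
    (hD : ∀ v, offDeg H w v ≤ D) (A : Finset V) (hA : BipSub H A) :
    t * (t - 1) + 2 * phiD D t ≤ 2 * j + 2 * (t * (D - 1)) := by
  have hid := deficiency_identity H hfree s t j D hs w hw hw1 hj hD
  have hcard := card_offEdges_add_deg H w
  have ht : (offEdges H w).card = t := by omega
  obtain ⟨h1, h2⟩ := sum_offDeg_side_eq H w A hA
  rw [ht] at h1 h2
  have hL := sum_mul_sub_ge_phi (univ.filter (fun v => v ∈ A ∧ v ≠ w)) (offDeg H w) D (fun x _ => hD x)
  have hR := sum_mul_sub_ge_phi (univ.filter (fun v => v ∉ A ∧ v ≠ w)) (offDeg H w) D (fun x _ => hD x)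
  rw [h1] at hL
  rw [h2] at hR
  rw [sum_erase_eq_side_add_side w A] at hid
  omega

end C047

end TriangleCap

end PercRepro
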